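import Literature.MathematicalPhysics.KineticTheory.LanfordTensorisedHierarchy
import Literature.MathematicalPhysics.KineticTheory.IllnerPulvirentiBoltzmannSeriesBounds
import Literature.MathematicalPhysics.KineticTheory.IllnerShinbrotExistence
import HarnessLib

/-!
# Global summation and factorisation of the Boltzmann-hierarchy series for a rare cloud in `ℝ^d`

Topic: MathematicalPhysics / KineticTheory. The Boltzmann-hierarchy side of the convergence half
of the named fact `Literature.MathematicalPhysics.KineticTheory.illner_pulvirenti` (hilbert6.S03;
Cercignani–Illner–Pulvirenti 1994 Thm 4.5.1, Steps 3–4 at `ε = 0`; Illner–Pulvirenti 1986/1989):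

* `IsMildBoltzmannHierarchySolutionOn.hasSum_boltzmannDuhamelTerm_global` — **global-in-time
  summation of the Duhamel series of the Boltzmann hierarchy on `ℝ^d`, `d ≥ 2`**: a jointly
  measurable mild solution `F` of the Boltzmann hierarchy on `[0, T]` in the *dispersive* Lanford
  class `|F^{(s)}(t, Z_s)| ≤ C c^s e^{-β₀ I_t(Z_s)} e^{-λ H(Z_s)}` (`I_t(Z_s) = ∑ |x_j - t v_j|²`)
  with `c` small — `2 c C_glob ≤ 1`, `C_glob = C_glob(d, β₀, λ)` the time-INDEPENDENT constant of
  `abs_boltzmannChain_le_global` — is the sum of its Duhamel series `∑_n Q⁰_{s,s+n}(t) F(0)` at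
  EVERY `t ∈ [0, T]`, however large `T` (CIP (5.9) for the terms, the same chain estimate for the
  remainders of the finitely iterated Duhamel formula
  `HierarchyModel.IsMildSolution.iterRem_spec`, geometric series of ratio `≤ 1/2`). This is the
  global twin of the prelude's short-time `hasSum_boltzmannDuhamelTerm` (same proof, the bound
  `abs_hierarchyChain_le ∝ tⁿ` replaced by the dispersive one).
* `IsMildBoltzmannSolutionOn.isMildBoltzmannHierarchySolutionOn_tensorPow_of_continuousOn` — the
  tensor powers of a mild Boltzmann solution solve the hierarchy, from explicit regularity
  hypotheses (variant of the `LanfordTensorisedHierarchy` theorem, whose Lanford-class hypothesis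
  the rare-cloud solution does not literally meet).
* `hasSum_boltzmannDuhamelTerm_tensorPow_vacuum` — **CIP 1994 Thm 4.5.1 at `ε = 0`**: for the
  global dispersive mild solution `f` of the rare cloud (jointly continuous,
  `|f(t, x, v)| ≤ c e^{-(β₀/2)(|x - t⁺v|² + |v|²)}`, mild on every `[0, T]` — the output of
  `illnerShinbrot_global_mild`) with `c` small, the Boltzmann-hierarchy series issued from the
  tensorised data `f₀^{⊗(s+n)}` sums, at EVERY `t ≥ 0`, to the tensor power `f(t)^{⊗s}`:
  "the series solution `f(·, t)` of the Boltzmann hierarchy … factorizes as `∏ f(x_i, ξ_i, t)` and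
  `f` is a mild global solution of the Boltzmann equation".

Theorems only. What remains of `illner_pulvirenti` after this file is the BBGKY side in `ℝ^d`:
the correlation functions of the grand-canonical hard-sphere data as a Duhamel series, their
global bounds along the interacting flow (CIP Lemma 4.2.3–4.2.4, (5.3)), and the term-by-term
convergence (CIP §4.4 Step 1).

## References

* C. Cercignani, R. Illner, M. Pulvirenti, *The Mathematical Theory of Dilute Gases*, Applied
  Mathematical Sciences 106, Springer (1994), §4.5 Thm 4.5.1 and its proof pp. 87–90; §4.4
  Thm 4.4.1 Steps 3–4, (4.16)–(4.19), pp. 83–85.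
* R. Illner, M. Pulvirenti, Comm. Math. Phys. 105 (1986) 189–203; 121 (1989) 143–146.
-/

open MeasureTheory Metric Real Set Filter Topology Function
open scoped InnerProductSpace ENNReal

namespace Literature.MathematicalPhysics.KineticTheory

noncomputable section

open Literature.Analysis.FluidPDE

variable {d : Type*} [Fintype d]


/-! ## 1. Global summation of the Duhamel series in the dispersive class -/

section Summation

/-- **Global-in-time summation of the Duhamel series of the Boltzmann hierarchy on `ℝ^d`**
(CIP 1994 Thm 4.5.1, Steps 3–4 at `ε = 0`). Let `d ≥ 2`, `T > 0`, and let `F = (F^{(s)}(t))_s`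
be a mild solution of the Boltzmann hierarchy on `[0, T]` for the Euclidean geometry, jointly
measurable in `(t, Z_s)` at every level, in the dispersive Lanford class
`|F^{(s)}(t, Z_s)| ≤ C c^s e^{-β₀ ∑_j |x_j - t v_j|²} e^{-λ H(Z_s)}` on `[0, T]`
(`C ≥ 0`, `c, β₀, λ > 0`). If `2 c C_glob ≤ 1` with the time-independent constant
`C_glob = e² 2^{(d+3)/2} λ^{-(d+1)/2} |S^{d-1}| 2^d (2^d ∫e^{-|u|²} + λ^{d/2} ∫e^{-β₀|u|²})` of
`abs_boltzmannChain_le_global`, then for every `s`, every `t ∈ [0, T]` and every `Z_s` the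
series `∑_n Q⁰_{s,s+n}(t) F(0) (Z_s)` is summable with sum `F^{(s)}(t, Z_s)` — with NO
restriction on `T`. [cite: CIP1994, §4.5 Thm 4.5.1 (proof, Step 3 (5.9) and p. 90)] -/
theorem _root_.Literature.Analysis.FluidPDE.IsMildBoltzmannHierarchySolutionOn.hasSum_boltzmannDuhamelTerm_global
    (hd : 2 ≤ Fintype.card d) {T : ℝ} (hT : 0 < T)
    {F : (s : ℕ) → ℝ → Config s d (EuclideanSpace ℝ d) → ℝ}
    (hF : IsMildBoltzmannHierarchySolutionOn T (Euclidean.geometry d) F)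
    (hmeas : ∀ s, Measurable fun p : ℝ × Config s d (EuclideanSpace ℝ d) => F s p.1 p.2)
    {C c β₀ lam : ℝ} (hC : 0 ≤ C) (hc : 0 < c) (hβ₀ : 0 < β₀) (hlam : 0 < lam)
    (hb : ∀ s, ∀ t ∈ Icc 0 T, ∀ Z : Config s d (EuclideanSpace ℝ d), |F s t Z| ≤
      C * c ^ s * (exp (-β₀ * ∑ j, ‖(Z j).1 - t • (Z j).2‖ ^ 2) * exp (-lam * configEnergy Z)))
    (hsmall : 2 * c *
      (exp 2 * (sqrt 2 ^ (Fintype.card d + 3) / sqrt lam ^ (Fintype.card d + 1)) *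
        ((KineticTheory.sphereMeasure : Measure (sphere (0 : EuclideanSpace ℝ d) 1)).real univ *
          (2 ^ Fintype.card d *
            (2 ^ Fintype.card d * (∫ w : (EuclideanSpace ℝ d), exp (-‖w‖ ^ 2)) +
              sqrt lam ^ Fintype.card d * ∫ w : (EuclideanSpace ℝ d), exp (-β₀ * ‖w‖ ^ 2))))) ≤ 1)
    (s : ℕ) {t : ℝ} (ht : t ∈ Icc 0 T) (Z : Config s d (EuclideanSpace ℝ d)) :
    HasSum (fun n => boltzmannDuhamelTerm (Euclidean.geometry d) n s t (fun k => F k 0) Z)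
      (F s t Z) := by
  set G := Euclidean.geometry d with hGdef
  have hG : Measurable fun p : (EuclideanSpace ℝ d) × (EuclideanSpace ℝ d) => G.translate p.1 p.2 :=
    measurable_add
  -- the global constant, as an opaque real number with its defining equation
  obtain ⟨Cg, hCg⟩ : ∃ Cg : ℝ, Cg = exp 2 * (sqrt 2 ^ (Fintype.card d + 3) / sqrt lam ^ (Fintype.card d + 1)) *
      ((KineticTheory.sphereMeasure : Measure (sphere (0 : EuclideanSpace ℝ d) 1)).real univ *
        (2 ^ Fintype.card d * (2 ^ Fintype.card d * (∫ w : (EuclideanSpace ℝ d), exp (-‖w‖ ^ 2)) +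
          sqrt lam ^ Fintype.card d * ∫ w : (EuclideanSpace ℝ d), exp (-β₀ * ‖w‖ ^ 2)))) := ⟨_, rfl⟩
  have hCg0 : 0 ≤ Cg := by
    have h1 : 0 ≤ ∫ w : (EuclideanSpace ℝ d), exp (-‖w‖ ^ 2) := integral_nonneg fun w => (exp_pos _).le
    have h2 : 0 ≤ ∫ w : (EuclideanSpace ℝ d), exp (-β₀ * ‖w‖ ^ 2) := integral_nonneg fun w => (exp_pos _).le
    have h3 : (0 : ℝ) ≤ (KineticTheory.sphereMeasure : Measure (sphere (0 : EuclideanSpace ℝ d) 1)).real univ := measureReal_nonneg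
    rw [hCg]
    positivity
  have hsmallCg : 2 * c * Cg ≤ 1 := by rw [hCg]; exact hsmall
  -- the dispersive weight is at most `1`, so `F` is in Lanford's class with `(C, c, λ)`
  have hexp1 : ∀ (τ : ℝ) (k : ℕ) (W : Config k d (EuclideanSpace ℝ d)),
      exp (-β₀ * ∑ j, ‖(W j).1 - τ • (W j).2‖ ^ 2) ≤ 1 := by
    intro τ k W
    have hS : 0 ≤ ∑ j, ‖(W j).1 - τ • (W j).2‖ ^ 2 := Finset.sum_nonneg fun j _ => sq_nonneg _
    have := mul_nonneg hβ₀.le hS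
    exact exp_le_one_iff.2 (by linarith)
  have hexp2 : ∀ (a : ℝ), 0 ≤ a → ∀ (k : ℕ) (W : Config k d (EuclideanSpace ℝ d)), exp (-a * configEnergy W) ≤ 1 := by
    intro a ha k W
    have hE := configEnergy_nonneg' W
    have := mul_nonneg ha hE
    exact exp_le_one_iff.2 (by linarith)
  have hW1 : ∀ (τ : ℝ) (k : ℕ) (W : Config k d (EuclideanSpace ℝ d)),
      exp (-β₀ * ∑ j, ‖(W j).1 - τ • (W j).2‖ ^ 2) * exp (-(lam / 2) * configEnergy W) ≤ 1 :=
    fun τ k W =>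
    calc _ ≤ 1 * 1 := mul_le_mul (hexp1 τ k W) (hexp2 (lam / 2) (half_pos hlam).le k W)
          (exp_pos _).le zero_le_one
      _ = 1 := mul_one _
  have hFb : ∀ k, ∀ τ ∈ Icc 0 T, ∀ W : Config k d (EuclideanSpace ℝ d),
      |F k τ W| ≤ C * c ^ k * exp (-lam * configEnergy W) := by
    intro k τ hτ W
    refine (hb k τ hτ W).trans ?_
    have h0 : 0 ≤ C * c ^ k := by positivity
    calc C * c ^ k * (exp (-β₀ * ∑ j, ‖(W j).1 - τ • (W j).2‖ ^ 2) * exp (-lam * configEnergy W))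
        ≤ C * c ^ k * (1 * exp (-lam * configEnergy W)) :=
          mul_le_mul_of_nonneg_left (mul_le_mul_of_nonneg_right (hexp1 τ k W) (exp_pos _).le) h0
      _ = C * c ^ k * exp (-lam * configEnergy W) := by rw [one_mul]
  -- the Boltzmann hierarchy as an abstract model; `F` is a two-time mild solution
  have hMF : (boltzmannModel G hG 1).IsMildSolution T F := by
    refine (boltzmannModel G hG 1).isMildSolution_of_duhamel_zero ?_
      (fun k => ⟨hmeas k, C * c ^ k, lam, hlam, hFb k⟩) ?_
    · intro k a a' W
      rw [boltzmannModel_flow]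
      exact freeFlight_add G a a' W
    · intro k τ hτ W
      rw [hF k τ hτ W, boltzmannModel_transport]
      congr 1
      refine intervalIntegral.integral_congr fun σ _ => ?_
      simp only [freeTransport_apply, boltzmannModel_op, one_mul]
  have ht0 : 0 ≤ t := ht.1
  -- the ratio of the geometric series
  set r : ℝ := c * Cg with hr
  have hr0 : 0 ≤ r := by positivity
  have hr2 : r ≤ 1 / 2 := by
    rw [hr]
    linarith
  have hr1 : r < 1 := hr2.trans_lt (by norm_num)
  -- the Duhamel terms of the tree are those of the model (rate `α = 1`)
  have hQ : ∀ (n : ℕ) (τ : ℝ) (k : ℕ) (W : Config k d (EuclideanSpace ℝ d)),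
      boltzmannDuhamelTerm G n k τ (fun j => F j 0) W =
        duhamelTerm (boltzmannModel G hG 1).transport (boltzmannModel G hG 1).op n k τ
          (fun j => F j 0) W := by
    intro n τ k W
    rw [duhamelTerm_boltzmannModel, one_pow, one_mul]
  -- the common majorant `K₀ rⁿ`
  set K₀ : ℝ := exp (s - 1) * C * c ^ s with hK₀
  have hK₀0 : 0 ≤ K₀ := by positivity
  have hconv : ∀ (n : ℕ) (τ : ℝ),
      exp (s - 1) * Cg ^ n * (C * c ^ (s + n)) *
          (exp (-β₀ * ∑ j, ‖(Z j).1 - τ • (Z j).2‖ ^ 2) * exp (-(lam / 2) * configEnergy Z)) ≤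
        K₀ * r ^ n := by
    intro n τ
    have hpre : 0 ≤ exp (s - 1) * Cg ^ n * (C * c ^ (s + n)) := by positivity
    calc exp (s - 1) * Cg ^ n * (C * c ^ (s + n)) *
          (exp (-β₀ * ∑ j, ‖(Z j).1 - τ • (Z j).2‖ ^ 2) * exp (-(lam / 2) * configEnergy Z))
        ≤ exp (s - 1) * Cg ^ n * (C * c ^ (s + n)) * 1 := mul_le_mul_of_nonneg_left (hW1 τ s Z) hpre
      _ = K₀ * r ^ n := by rw [hK₀, hr, pow_add, mul_pow]; ring
  -- (a) the Duhamel terms: `|Q⁰_{s,s+n}(t) F(0)| ≤ K₀ rⁿ` for `n ≥ 1`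
  have hQb : ∀ n, 1 ≤ n → |boltzmannDuhamelTerm G n s t (fun k => F k 0) Z| ≤ K₀ * r ^ n := by
    intro n hn
    have hB : 0 ≤ C * c ^ (s + n) := by positivity
    have hdata : ∀ W : Config (s + n) d (EuclideanSpace ℝ d), |(fun k => F k 0) (s + n) W| ≤
        C * c ^ (s + n) * (exp (-β₀ * ∑ j, ‖(W j).1‖ ^ 2) * exp (-lam * configEnergy W)) := by
      intro W
      have h := hb (s + n) 0 ⟨le_rfl, hT.le⟩ W
      simpa only [zero_smul, sub_zero] using h
    have h := abs_boltzmannDuhamelTerm_le_global hd hβ₀ hlam hB (fun k => F k 0) s n hn hdata ht0 Z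
    rw [← hCg] at h
    exact h.trans (hconv n t)
  -- (b) the remainders of the finite Duhamel iteration: `|R_n(t)| ≤ K₀ rⁿ` for `n ≥ 1`
  have hRb : ∀ n, 1 ≤ n → |(boltzmannModel G hG 1).iterRem F 0 n s t Z| ≤ K₀ * r ^ n := by
    intro n hn
    have hB : 0 ≤ C * c ^ (s + n) := by positivity
    have hR : ∀ (m k : ℕ) (τ : ℝ) (W : Config k d (EuclideanSpace ℝ d)),
        (boltzmannModel G hG 1).iterRem F 0 (m + 1) k τ W = ∫ σ in (0 : ℝ)..τ,
          freeTransport (Euclidean.geometry d) k (τ - σ)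
            (boltzmannHOp (Euclidean.geometry d) k ((boltzmannModel G hG 1).iterRem F 0 m (k + 1) σ)) W := by
      intro m k τ W
      rw [(boltzmannModel G hG 1).iterRem_succ F 0 m k τ W]
      refine intervalIntegral.integral_congr fun σ _ => ?_
      simp only [boltzmannModel_transport, boltzmannModel_op, freeTransport_apply, one_mul, hGdef]
    have h := abs_boltzmannChain_le_global hd hβ₀ hlam hB ((boltzmannModel G hG 1).iterRem F 0) hR
      hT.le s n hn (fun τ hτ W => by
        rw [HierarchyModel.iterRem_zero, zero_add]
        exact hb (s + n) τ hτ W) ht Z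
    rw [← hCg] at h
    exact h.trans (hconv n t)
  -- (c) the finite Duhamel iteration with remainder (linearity; uses `hG` through the model)
  have hspec : ∀ n : ℕ, ∑ j ∈ Finset.range n, boltzmannDuhamelTerm G j s t (fun k => F k 0) Z =
      F s t Z - (boltzmannModel G hG 1).iterRem F 0 n s t Z := by
    intro n
    have h := hMF.iterRem_spec le_rfl hT.le n s t (by rw [sub_zero]; exact ht) Z
    rw [zero_add] at h
    simp only [hQ]
    linarith
  -- (d) absolute convergence of the series
  have hmaj0 : ∀ n : ℕ, K₀ * r ^ n ≤ (C * c ^ s + K₀) * r ^ n := fun n => by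
    have : 0 ≤ C * c ^ s := by positivity
    gcongr
    linarith
  have hgeom : Summable fun n : ℕ => (C * c ^ s + K₀) * r ^ n :=
    (summable_geometric_of_lt_one hr0 hr1).mul_left _
  have hbd : ∀ n : ℕ,
      ‖boltzmannDuhamelTerm G n s t (fun k => F k 0) Z‖ ≤ (C * c ^ s + K₀) * r ^ n := by
    intro n
    rw [Real.norm_eq_abs]
    rcases Nat.eq_zero_or_pos n with rfl | hn
    · rw [pow_zero, mul_one, boltzmannDuhamelTerm, duhamelTerm_zero, freeTransport_apply]
      calc |F s 0 (freeFlight G (-t) Z)|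
          ≤ C * c ^ s * exp (-lam * configEnergy (freeFlight G (-t) Z)) :=
            hFb s 0 ⟨le_rfl, hT.le⟩ _
        _ ≤ C * c ^ s * 1 := by
            rw [configEnergy_freeFlight]
            exact mul_le_mul_of_nonneg_left (hexp2 lam hlam.le s Z) (by positivity)
        _ ≤ C * c ^ s + K₀ := by linarith
    · exact (hQb n hn).trans (hmaj0 n)
  have hsum : Summable fun n => boltzmannDuhamelTerm G n s t (fun k => F k 0) Z :=
    Summable.of_norm_bounded hgeom hbd
  -- (e) the partial sums `F^{(s)}(t) - R_n(t)` converge to `F^{(s)}(t)`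
  have hrem : Tendsto (fun n => (boltzmannModel G hG 1).iterRem F 0 n s t Z) atTop (𝓝 0) := by
    have hg : Tendsto (fun n : ℕ => (C * c ^ s + K₀) * r ^ n) atTop (𝓝 0) := by
      simpa using (tendsto_pow_atTop_nhds_zero_of_lt_one hr0 hr1).const_mul (C * c ^ s + K₀)
    refine squeeze_zero_norm (fun n => ?_) hg
    rw [Real.norm_eq_abs]
    rcases Nat.eq_zero_or_pos n with rfl | hn
    · rw [pow_zero, mul_one, HierarchyModel.iterRem_zero, zero_add]
      calc |F s t Z| ≤ C * c ^ s * exp (-lam * configEnergy Z) := hFb s t ht Z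
        _ ≤ C * c ^ s * 1 := mul_le_mul_of_nonneg_left (hexp2 lam hlam.le s Z) (by positivity)
        _ ≤ C * c ^ s + K₀ := by linarith
    · exact (hRb n hn).trans (hmaj0 n)
  have hlim : Tendsto (fun n => ∑ j ∈ Finset.range n,
      boltzmannDuhamelTerm G j s t (fun k => F k 0) Z) atTop (𝓝 (F s t Z)) := by
    have h := (tendsto_const_nhds (x := F s t Z)).sub hrem
    rw [sub_zero] at h
    exact h.congr fun n => (hspec n).symm
  -- (f) conclusion
  have h := hsum.hasSum
  rwa [tendsto_nhds_unique h.tendsto_sum_nat hlim] at h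

end Summation

/-! ## 2. Tensor powers solve the hierarchy (explicit regularity hypotheses) -/

section Hierarchy

variable {X : Type*} [TopologicalSpace X] [FirstCountableTopology X]

omit [FirstCountableTopology X] in
/-- **Tensor powers of a mild Boltzmann solution form a mild solution of the Boltzmann
hierarchy — version with explicit regularity hypotheses.** The theorem
`IsMildBoltzmannSolutionOn.isMildBoltzmannHierarchySolutionOn_tensorPow` of
`LanfordTensorisedHierarchy` (CIP 1994 Thm 4.4.1 Step 4, (4.19)) assumes Lanford's class
`C([0, T]; X_β)`, of which its proof uses three consequences only: a uniform Gaussian velocity bound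
on `[0, T]`, continuity of the slices `f(t)`, and joint continuity of the collision term on
`[0, T] × X × ℝ^d`. This is the same statement and proof from those three hypotheses (needed for
the rare cloud, whose solution is controlled in the dispersive class rather than in
`C([0, T]; X_β)`). [cite: CIP1994, §4.4 Thm 4.4.1 Step 4, (4.19), p. 85] -/
theorem _root_.Literature.Analysis.FluidPDE.IsMildBoltzmannSolutionOn.isMildBoltzmannHierarchySolutionOn_tensorPow_of_continuousOn
    {G : Geometry d X} (hGc : Continuous fun p : X × (EuclideanSpace ℝ d) => G.translate p.1 p.2)
    {T β : ℝ} (hβ : 0 < β) {f : ℝ → X → (EuclideanSpace ℝ d) → ℝ}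
    (hf : IsMildBoltzmannSolutionOn T G hardSphereKernel f)
    {N : ℝ} (hN : ∀ t ∈ Icc 0 T, ∀ x v, |f t x v| ≤ N * exp (-(β / 2) * ‖v‖ ^ 2))
    (hslice : ∀ t ∈ Icc 0 T, Continuous (uncurry (f t)))
    (hQc : ContinuousOn (fun p : ℝ × X × (EuclideanSpace ℝ d) =>
      collisionTerm hardSphereKernel f p.1 p.2.1 p.2.2) (Icc 0 T ×ˢ univ)) :
    IsMildBoltzmannHierarchySolutionOn T G (fun s t => tensorPow s (uncurry (f t))) := by
  classical
  intro s t ht Zs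
  -- the feet `y_i = x_i - t v_i` of the characteristics, the factors `a_i` and their derivatives
  obtain ⟨y, hy⟩ : ∃ y : Fin s → X, y = fun i => G.translate (Zs i).1 ((-t) • (Zs i).2) :=
    ⟨_, rfl⟩
  obtain ⟨a, ha_def⟩ : ∃ a : Fin s → ℝ → ℝ, a = fun i τ => alongFlow G f τ (y i) (Zs i).2 :=
    ⟨_, rfl⟩
  obtain ⟨q, hq_def⟩ : ∃ q : Fin s → ℝ → ℝ,
      q = fun i τ => alongFlow G (collisionTerm hardSphereKernel f) τ (y i) (Zs i).2 := ⟨_, rfl⟩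
  have hq : ∀ i, ContinuousOn (q i) (Icc 0 T) := by
    intro i
    have h1 : Continuous fun τ : ℝ => G.translate (y i) (τ • (Zs i).2) :=
      hGc.comp (continuous_const.prodMk (continuous_id.smul continuous_const))
    have hpath : Continuous fun τ : ℝ => (τ, G.translate (y i) (τ • (Zs i).2), (Zs i).2) :=
      continuous_id.prodMk (h1.prodMk continuous_const)
    have h := hQc.comp hpath.continuousOn fun τ hτ => ⟨hτ, mem_univ _⟩
    refine h.congr fun τ _ => ?_
    simp only [hq_def, Function.comp_apply, alongFlow]
  have ha : ∀ i, ∀ τ ∈ Icc 0 T, a i τ = a i 0 + ∫ σ in (0 : ℝ)..τ, q i σ := by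
    intro i τ hτ
    have e := hf.duhamel (y i) (Zs i).2 τ hτ
    simp only [ha_def, hq_def, alongFlow_zero]
    exact e
  have key := prod_eq_prod_add_integral_sum hq ha ht
  -- identification of the three terms of the hierarchy's Duhamel formula
  have hx : ∀ i, G.translate (y i) (t • (Zs i).2) = (Zs i).1 := fun i => by
    simp only [hy, Geometry.translate_add, neg_smul, neg_add_cancel, Geometry.translate_zero]
  have h1 : tensorPow s (uncurry (f t)) Zs = ∏ i, a i t := by
    refine Finset.prod_congr rfl fun i _ => ?_
    simp only [ha_def, alongFlow, hx i]
    rfl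
  have h2 : freeTransport G s t (tensorPow s (uncurry (f 0))) Zs = ∏ i, a i 0 := by
    simp only [freeTransport_apply, tensorPow, ha_def, alongFlow_zero]
    refine Finset.prod_congr rfl fun i _ => ?_
    simp only [freeFlight_apply, hy]
    rfl
  have h3 : EqOn
      (fun τ => freeTransport G s (t - τ)
        (boltzmannHOp G s (tensorPow (s + 1) (uncurry (f τ)))) Zs)
      (fun τ => ∑ i, (∏ j ∈ Finset.univ.erase i, a j τ) * q i τ) (uIcc 0 t) := by
    intro τ hτ
    rw [uIcc_of_le ht.1] at hτ
    have hτT : τ ∈ Icc 0 T := ⟨hτ.1, hτ.2.trans ht.2⟩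
    have hW : ∀ j, G.translate (Zs j).1 ((-(t - τ)) • (Zs j).2) = G.translate (y j) (τ • (Zs j).2) :=
      fun j => by simp only [hy, Geometry.translate_add, neg_smul_add_smul_eq]
    have hFm : ∀ i, Measurable fun w =>
        uncurry (f τ) ((freeFlight G (-(t - τ)) Zs i).1, w) := fun i =>
      ((hslice τ hτT).comp (continuous_const.prodMk continuous_id)).measurable
    have hFb : ∀ i w, |uncurry (f τ) ((freeFlight G (-(t - τ)) Zs i).1, w)| ≤
        N * exp (-(β / 2) * ‖w‖ ^ 2) := fun i w => hN τ hτT _ w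
    simp only [freeTransport_apply]
    rw [boltzmannHOp_tensorPow G hβ (uncurry (f τ)) (freeFlight G (-(t - τ)) Zs) hFm hFb]
    refine Finset.sum_congr rfl fun i _ => ?_
    congr 1
    · refine Finset.prod_congr rfl fun j _ => ?_
      simp only [ha_def, alongFlow, freeFlight_apply, hW j]
      rfl
    · simp only [hq_def, alongFlow, collisionTerm, collisionOpWith_hardSphereKernel,
        freeFlight_apply, hW i]
      rfl
  beta_reduce
  rw [h1, h2, intervalIntegral.integral_congr h3]
  exact key


end Hierarchy

/-! ## 3. The rare cloud: the hierarchy series factorises globally -/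

section Vacuum

/-- The dispersive bound of a tensor power: if `|f(x, v)| ≤ c e^{-(β₀/2)(|x - tv|² + |v|²)}` then
`|f^{⊗s}(Z_s)| ≤ c^s e^{-(β₀/2) ∑ |x_j - t v_j|²} e^{-β₀ H(Z_s)}` (`H = ½ ∑ |v_j|²`). [folklore] -/
theorem abs_tensorPow_le_dispersive {c β₀ t : ℝ} {F : (EuclideanSpace ℝ d) × (EuclideanSpace ℝ d) → ℝ}
    (hF : ∀ x v, |F (x, v)| ≤ c * exp (-(β₀ / 2) * (‖x - t • v‖ ^ 2 + ‖v‖ ^ 2)))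
    {s : ℕ} (Zs : Config s d (EuclideanSpace ℝ d)) :
    |tensorPow s F Zs| ≤ c ^ s *
      (exp (-(β₀ / 2) * ∑ j, ‖(Zs j).1 - t • (Zs j).2‖ ^ 2) * exp (-β₀ * configEnergy Zs)) := by
  unfold tensorPow
  rw [Finset.abs_prod]
  calc ∏ i, |F (Zs i)| ≤ ∏ i, c * exp (-(β₀ / 2) * (‖(Zs i).1 - t • (Zs i).2‖ ^ 2 + ‖(Zs i).2‖ ^ 2)) :=
        Finset.prod_le_prod (fun i _ => abs_nonneg _) fun i _ => by
          have h := hF (Zs i).1 (Zs i).2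
          rwa [Prod.mk.eta] at h
    _ = c ^ s * (exp (-(β₀ / 2) * ∑ j, ‖(Zs j).1 - t • (Zs j).2‖ ^ 2) *
          exp (-β₀ * configEnergy Zs)) := by
        rw [Finset.prod_mul_distrib, Finset.prod_const, Finset.card_univ, Fintype.card_fin,
          ← Real.exp_sum, ← Real.exp_add]
        congr 2
        rw [configEnergy, Finset.mul_sum, Finset.mul_sum, Finset.mul_sum, ← Finset.sum_add_distrib]
        exact Finset.sum_congr rfl fun i _ => by ring

/-- **CIP 1994 Thm 4.5.1 at `ε = 0`: the Boltzmann-hierarchy series of the rare cloud factorises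
globally.** Let `d ≥ 2`, `β₀ > 0`, and let `f` be a global dispersive mild solution of the
hard-sphere Boltzmann equation on `ℝ^d` — jointly continuous,
`|f(t, x, v)| ≤ c e^{-(β₀/2)(|x - t⁺v|² + |v|²)}`, a mild solution on every `[0, T]` (hence
`f(t) ≥ 0` for `t ≥ 0`), as produced by `illnerShinbrot_global_mild` — with `c` so small that
`2 c C_glob(d, β₀/2, β₀) ≤ 1`. Then for every `T > 0`, `s`, `t ∈ [0, T]` and `Z_s` the Duhamel
series of the Boltzmann hierarchy issued from the tensorised data `(f(0)^{⊗k})_k` sums to the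
tensor power of the solution: `∑_n Q⁰_{s,s+n}(t) [f(0)^{⊗(s+n)}] (Z_s) = ∏_i f(t, z_i)` ("the
series solution of the Boltzmann hierarchy … factorizes, and `f` is a mild global solution of
the Boltzmann equation"). [cite: CIP1994, §4.5 Thm 4.5.1] -/
theorem hasSum_boltzmannDuhamelTerm_tensorPow_vacuum (hd : 2 ≤ Fintype.card d) {β₀ c : ℝ}
    (hβ₀ : 0 < β₀) (hc : 0 < c) {f : ℝ → (EuclideanSpace ℝ d) → (EuclideanSpace ℝ d) → ℝ}
    (hmild : ∀ T > (0 : ℝ), IsMildBoltzmannSolutionOn T (Euclidean.geometry d) hardSphereKernel f)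
    (hcont : Continuous fun z : ℝ × (EuclideanSpace ℝ d) × (EuclideanSpace ℝ d) => f z.1 z.2.1 z.2.2)
    (hbound : ∀ t x v, |f t x v| ≤ c * exp (-(β₀ / 2) * (‖x - max 0 t • v‖ ^ 2 + ‖v‖ ^ 2)))
    (hsmall : 2 * c *
      (exp 2 * (sqrt 2 ^ (Fintype.card d + 3) / sqrt β₀ ^ (Fintype.card d + 1)) *
        ((KineticTheory.sphereMeasure : Measure (sphere (0 : EuclideanSpace ℝ d) 1)).real univ *
          (2 ^ Fintype.card d *
            (2 ^ Fintype.card d * (∫ w : (EuclideanSpace ℝ d), exp (-‖w‖ ^ 2)) +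
              sqrt β₀ ^ Fintype.card d * ∫ w : (EuclideanSpace ℝ d), exp (-(β₀ / 2) * ‖w‖ ^ 2))))) ≤ 1)
    {T : ℝ} (hT : 0 < T) (s : ℕ) {t : ℝ} (ht : t ∈ Icc 0 T) (Zs : Config s d (EuclideanSpace ℝ d)) :
    HasSum (fun n => boltzmannDuhamelTerm (Euclidean.geometry d) n s t
        (fun k => tensorPow k (uncurry (f 0))) Zs)
      (tensorPow s (uncurry (f t)) Zs) := by
  -- the velocity Gaussian bound and the slices
  have hc0 : 0 ≤ c := hc.le
  have hvel : ∀ t x v, |f t x v| ≤ c * exp (-(β₀ / 2) * ‖v‖ ^ 2) := fun t x v =>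
    (hbound t x v).trans (mul_le_mul_of_nonneg_left (exp_dispersive_le_exp_velocity hβ₀.le _ v) hc0)
  have hslice : ∀ t, Continuous (uncurry (f t)) := fun t =>
    hcont.comp (continuous_const.prodMk continuous_id)
  -- the collision term is jointly continuous on `[0, T] × ℝ^d × ℝ^d` (it is the sign-corrected
  -- one there, `f(t) ≥ 0`)
  obtain ⟨Qa, hQa⟩ : ∃ Qa : ((EuclideanSpace ℝ d) → ℝ) → (EuclideanSpace ℝ d) → ℝ, ∀ p v, Qa p v = ∫ w, ∫ ω, hardSphereKernel (v, w) ω *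
      (|p (collide ω (v, w)).1| * |p (collide ω (v, w)).2| - p v * |p w|) ∂sphereMeasure :=
    ⟨_, fun p v => rfl⟩
  have hQac := continuous_absCollision_slice' hQa hcont hβ₀ hvel
  have hnonneg : ∀ t, 0 ≤ t → ∀ x v, 0 ≤ f t x v := fun t ht x v =>
    (hmild (t + 1) (by linarith)).nonneg t ⟨ht, by linarith⟩ x v
  have hQc : ContinuousOn (fun p : ℝ × (EuclideanSpace ℝ d) × (EuclideanSpace ℝ d) =>
      collisionTerm hardSphereKernel f p.1 p.2.1 p.2.2) (Icc 0 T ×ˢ univ) := by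
    refine (hQac.continuousOn (s := Icc 0 T ×ˢ univ)).congr fun p hp => ?_
    simp only [collisionTerm]
    exact (absCollision_eq_collisionOpWith hQa (fun w => hnonneg p.1 hp.1.1 p.2.1 w) p.2.2).symm
  -- the tensor powers form a mild hierarchy solution on `[0, T]`, jointly measurable
  have hF : IsMildBoltzmannHierarchySolutionOn T (Euclidean.geometry d)
      (fun k τ => tensorPow k (uncurry (f τ))) :=
    (hmild T hT).isMildBoltzmannHierarchySolutionOn_tensorPow_of_continuousOn
      (continuous_fst.add continuous_snd :
        Continuous fun p : (EuclideanSpace ℝ d) × (EuclideanSpace ℝ d) => (Euclidean.geometry d).translate p.1 p.2) hβ₀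
      (fun τ _ x v => hvel τ x v) (fun τ _ => hslice τ) hQc
  have hmeas : ∀ k, Measurable fun p : ℝ × Config k d (EuclideanSpace ℝ d) => tensorPow k (uncurry (f p.1)) p.2 := by
    intro k
    refine Continuous.measurable ?_
    unfold tensorPow
    refine continuous_finsetProd _ fun i _ => ?_
    exact hcont.comp (continuous_fst.prodMk
      ((((continuous_apply i).comp continuous_snd).fst).prodMk
        (((continuous_apply i).comp continuous_snd).snd)))
  -- the dispersive Lanford-class bound with `(C, c, β₀/2, β₀) = (1, c, β₀/2, β₀)`
  have hb : ∀ k, ∀ τ ∈ Icc 0 T, ∀ W : Config k d (EuclideanSpace ℝ d), |tensorPow k (uncurry (f τ)) W| ≤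
      1 * c ^ k * (exp (-(β₀ / 2) * ∑ j, ‖(W j).1 - τ • (W j).2‖ ^ 2) *
        exp (-β₀ * configEnergy W)) := by
    intro k τ hτ W
    rw [one_mul]
    refine abs_tensorPow_le_dispersive (fun x v => ?_) W
    have h := hbound τ x v
    rw [max_eq_right hτ.1] at h
    exact h
  exact hF.hasSum_boltzmannDuhamelTerm_global hd hT hmeas zero_le_one hc (half_pos hβ₀) hβ₀ hb
    hsmall s ht Zs

end Vacuum

/-! ## 4. The existence theorem with a free small constant -/

section ExistenceMono

/-- **Global mild solutions for a rare cloud, for every datum size below the threshold** — the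
theorem `illnerShinbrot_global_mild` (CIP 1994 Thm 5.2.2 = Illner–Shinbrot 1984) with the
constant of the datum decoupled from the threshold: there is `c₀ = c₀(d, β₀) > 0` such that for
EVERY `0 < c ≤ c₀` and every continuous `0 ≤ f₀ ≤ c e^{-(β₀/2)(|x|² + |v|²)}` the solution
exists with the bound `|f(t, x, v)| ≤ 2c e^{-(β₀/2)(|x - t⁺v|² + |v|²)}` (same proof: the
smallness conditions of the Picard scheme are monotone in the size of the datum). This is the
form needed to meet the second smallness condition of the series summation.
[cite: CIP1994, Thm 5.2.2] -/
theorem illnerShinbrot_global_mild_of_le {β₀ : ℝ} (hβ₀ : 0 < β₀) :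
    ∃ c₀ > (0 : ℝ), ∀ c : ℝ, 0 < c → c ≤ c₀ →
      ∀ f₀ : EuclideanSpace ℝ d → EuclideanSpace ℝ d → ℝ,
      Continuous (Function.uncurry f₀) →
      (∀ x v, 0 ≤ f₀ x v ∧ f₀ x v ≤ c * exp (-(β₀ / 2) * (‖x‖ ^ 2 + ‖v‖ ^ 2))) →
      ∃ f : ℝ → EuclideanSpace ℝ d → EuclideanSpace ℝ d → ℝ,
        (∀ T > (0 : ℝ),
          IsMildBoltzmannSolutionOn T (Euclidean.geometry d) hardSphereKernel f) ∧
        f 0 = f₀ ∧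
        Continuous (fun z : ℝ × EuclideanSpace ℝ d × EuclideanSpace ℝ d => f z.1 z.2.1 z.2.2) ∧
        (∀ t x v, |f t x v| ≤ 2 * c * exp (-(β₀ / 2) * (‖x - max 0 t • v‖ ^ 2 + ‖v‖ ^ 2))) := by
  -- constants
  set S : ℝ := (sphereMeasure : Measure (sphere (0 : EuclideanSpace ℝ d) 1)).real univ with hS
  set Kβ : ℝ := √(2 * π / β₀) * ∫ w : EuclideanSpace ℝ d, exp (-(β₀ / 2) * ‖w‖ ^ 2) with hKβ
  have hS0 : 0 ≤ S := measureReal_nonneg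
  have hKβ0 : 0 ≤ Kβ := mul_nonneg (Real.sqrt_nonneg _) (integral_nonneg fun w => (exp_pos _).le)
  set A : ℝ := 16 * S * Kβ with hA_def
  have hA0 : 0 ≤ A := by positivity
  set c₀ : ℝ := 1 / (A + 1) with hc₀_def
  have hc₀ : 0 < c₀ := by positivity
  have hAc₀ : A * c₀ ≤ 1 := by
    rw [hc₀_def, mul_one_div, div_le_one (by positivity)]
    linarith
  refine ⟨c₀, hc₀, fun c hc hcc₀ f₀ hf₀c hf₀b => ?_⟩
  have hAc : A * c ≤ 1 := (mul_le_mul_of_nonneg_left hcc₀ hA0).trans hAc₀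
  -- the smallness conditions with `R = 2 c`
  have hR : (0 : ℝ) ≤ 2 * c := by positivity
  have hsmall₂ : 4 * S * Kβ * (2 * c) ≤ 1 / 2 := by
    have : 4 * S * Kβ * (2 * c) = A * c / 2 := by simp only [hA_def]; ring
    rw [this]
    linarith
  have hsmall₁ : c + 4 * S * Kβ * (2 * c) * (2 * c) ≤ 2 * c := by
    have : 4 * S * Kβ * (2 * c) * (2 * c) = c * (A * c) := by simp only [hA_def]; ring
    rw [this]
    nlinarith [mul_le_mul_of_nonneg_left hAc hc.le]
  have hf₀nn : ∀ x v, 0 ≤ f₀ x v := fun x v => (hf₀b x v).1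
  have hf₀b' : ∀ x v, |f₀ x v| ≤ c * exp (-(β₀ / 2) * (‖x‖ ^ 2 + ‖v‖ ^ 2)) := fun x v => by
    rw [abs_of_nonneg (hf₀nn x v)]
    exact (hf₀b x v).2
  -- the sign-corrected collision operator and the Picard map
  obtain ⟨Qa, hQa⟩ : ∃ Qa : (EuclideanSpace ℝ d → ℝ) → EuclideanSpace ℝ d → ℝ, ∀ p v, Qa p v =
      ∫ w, ∫ ω, hardSphereKernel (v, w) ω *
        (|p (collide ω (v, w)).1| * |p (collide ω (v, w)).2| - p v * |p w|) ∂sphereMeasure :=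
    ⟨_, fun p v => rfl⟩
  obtain ⟨Φ, hΦ⟩ : ∃ Φ : (ℝ → EuclideanSpace ℝ d → EuclideanSpace ℝ d → ℝ) → ℝ → EuclideanSpace ℝ d →
      EuclideanSpace ℝ d → ℝ, ∀ u t y v, Φ u t y v =
      f₀ (y - max 0 t • v) v +
        ∫ τ in (0 : ℝ)..max 0 t, Qa (u τ (y - (max 0 t - τ) • v)) v := ⟨_, fun _ _ _ _ => rfl⟩
  obtain ⟨u, hu, hub, hfix⟩ := vacuumPicard_fixedPoint_exists hQa hβ₀ hR hf₀c hf₀b' hsmall₁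
    hsmall₂ hΦ
  -- the velocity Gaussian bound
  have hub' : ∀ t y v, |u t y v| ≤ 2 * c * exp (-(β₀ / 2) * ‖v‖ ^ 2) := fun t y v =>
    (hub t y v).trans (mul_le_mul_of_nonneg_left (exp_dispersive_le_exp_velocity hβ₀.le _ v) hR)
  have hmild := fun T : ℝ => vacuumPicard_fixedPoint_isMild hQa hβ₀ hf₀nn hu hub'
    (fun t y v => (hΦ u t y v).symm.trans (hfix t y v)) T
  exact ⟨u, fun T _ => (hmild T).1, (hmild 0).2, hu, hub⟩

end ExistenceMono

/-! ## 5. The Boltzmann side of `illner_pulvirenti`, assembled -/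

section BoltzmannSide

/-- **Illner–Pulvirenti / CIP 1994 Thm 4.5.1 — everything except the BBGKY side, in the shape
of the named fact `illner_pulvirenti`.** Let `d ≥ 2` and `β₀ > 0`. There is `c₀ = c₀(d, β₀) > 0`
such that for every continuous `f₀` with `0 ≤ f₀(x, v) ≤ c₀ e^{-(β₀/2)(|x|² + |v|²)}`:
(1) the hard-sphere Boltzmann equation on `ℝ^d` has a global mild solution `f` (mild on every
`[0, T]`), (2) `f(0) = f₀`, (3) `0 ≤ f(t, x, v) ≤ C e^{-(β/2)(|x - tv|² + |v|²)}` for `t ≥ 0`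
(`C = 2c₀`, `β = β₀`) — the first three conjuncts of `illner_pulvirenti` verbatim — and
(4⁰) for every `t ≥ 0`, `s` and `Z_s`, the Duhamel series of the Boltzmann hierarchy issued
from `(f₀^{⊗k})_k` sums to `f(t)^{⊗s}(Z_s)` (CIP Thm 4.5.1: "the series solution `f(·, t)` of
the Boltzmann hierarchy … factorizes as `∏ f(x_i, ξ_i, t)` and `f` is a mild global solution of
the Boltzmann equation for the initial value `f₀`"). The fourth conjunct of the named fact — the
convergence of the BBGKY correlation functions of the hard-sphere gas to these limits — is the
part not proved in the tree. [cite: CIP1994, §4.5 Thm 4.5.1 and Thm 5.2.2] -/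
theorem illner_pulvirenti_boltzmann_side (hd : 2 ≤ Fintype.card d) {β₀ : ℝ} (hβ₀ : 0 < β₀) :
    ∃ c₀ > (0 : ℝ), ∀ f₀ : EuclideanSpace ℝ d → EuclideanSpace ℝ d → ℝ,
      Continuous (uncurry f₀) →
      (∀ x v, 0 ≤ f₀ x v ∧ f₀ x v ≤ c₀ * exp (-(β₀ / 2) * (‖x‖ ^ 2 + ‖v‖ ^ 2))) →
      ∃ f : ℝ → EuclideanSpace ℝ d → EuclideanSpace ℝ d → ℝ,
        (∀ T > (0 : ℝ),
          IsMildBoltzmannSolutionOn T (Euclidean.geometry d) hardSphereKernel f) ∧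
        f 0 = f₀ ∧
        (∃ C β : ℝ, 0 < β ∧ ∀ t ≥ (0 : ℝ), ∀ x v,
          0 ≤ f t x v ∧ f t x v ≤ C * exp (-(β / 2) * (‖x - t • v‖ ^ 2 + ‖v‖ ^ 2))) ∧
        ∀ t ≥ (0 : ℝ), ∀ (s : ℕ) (Zs : Config s d (EuclideanSpace ℝ d)),
          HasSum (fun n => boltzmannDuhamelTerm (Euclidean.geometry d) n s t
              (fun k => tensorPow k (uncurry f₀)) Zs)
            (tensorPow s (uncurry (f t)) Zs) := by
  obtain ⟨c₁, hc₁, hE⟩ := illnerShinbrot_global_mild_of_le (d := d) hβ₀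
  -- the global series constant with `(dispersive parameter, energy weight) = (β₀/2, β₀)`
  obtain ⟨Cg, hCg⟩ : ∃ Cg : ℝ, Cg =
      exp 2 * (sqrt 2 ^ (Fintype.card d + 3) / sqrt β₀ ^ (Fintype.card d + 1)) *
        ((KineticTheory.sphereMeasure : Measure (sphere (0 : EuclideanSpace ℝ d) 1)).real univ *
          (2 ^ Fintype.card d *
            (2 ^ Fintype.card d * (∫ w : EuclideanSpace ℝ d, exp (-‖w‖ ^ 2)) +
              sqrt β₀ ^ Fintype.card d * ∫ w : EuclideanSpace ℝ d, exp (-(β₀ / 2) * ‖w‖ ^ 2)))) :=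
    ⟨_, rfl⟩
  have hCg0 : 0 ≤ Cg := by
    have h1 : 0 ≤ ∫ w : EuclideanSpace ℝ d, exp (-‖w‖ ^ 2) := integral_nonneg fun w => (exp_pos _).le
    have h2 : 0 ≤ ∫ w : EuclideanSpace ℝ d, exp (-(β₀ / 2) * ‖w‖ ^ 2) :=
      integral_nonneg fun w => (exp_pos _).le
    have h3 : (0 : ℝ) ≤ (KineticTheory.sphereMeasure : Measure (sphere (0 : EuclideanSpace ℝ d) 1)).real univ :=
      measureReal_nonneg
    rw [hCg]
    positivity
  -- the threshold: below the existence threshold and `4 c₀ Cg ≤ 1`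
  set c₀ : ℝ := min c₁ (1 / (4 * Cg + 1)) with hc₀
  have hc₀pos : 0 < c₀ := lt_min hc₁ (by positivity)
  have hc₀c₁ : c₀ ≤ c₁ := min_le_left _ _
  have hsmall : 2 * (2 * c₀) * Cg ≤ 1 := by
    have h1 : c₀ ≤ 1 / (4 * Cg + 1) := min_le_right _ _
    have h2 : c₀ * (4 * Cg + 1) ≤ 1 := by
      rw [le_div_iff₀ (by positivity)] at h1
      exact h1
    nlinarith
  refine ⟨c₀, hc₀pos, fun f₀ hf₀c hf₀b => ?_⟩
  obtain ⟨f, hmild, hf0, hcont, hbound⟩ := hE c₀ hc₀pos hc₀c₁ f₀ hf₀c hf₀b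
  refine ⟨f, hmild, hf0, ⟨2 * c₀, β₀, hβ₀, fun t ht x v => ⟨?_, ?_⟩⟩, fun t ht s Zs => ?_⟩
  · exact (hmild (t + 1) (by linarith)).nonneg t ⟨ht, by linarith⟩ x v
  · have h := (le_abs_self _).trans (hbound t x v)
    rwa [max_eq_right ht] at h
  · have hsmall' : 2 * (2 * c₀) *
        (exp 2 * (sqrt 2 ^ (Fintype.card d + 3) / sqrt β₀ ^ (Fintype.card d + 1)) *
          ((KineticTheory.sphereMeasure : Measure (sphere (0 : EuclideanSpace ℝ d) 1)).real univ *
            (2 ^ Fintype.card d *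
              (2 ^ Fintype.card d * (∫ w : EuclideanSpace ℝ d, exp (-‖w‖ ^ 2)) +
                sqrt β₀ ^ Fintype.card d * ∫ w : EuclideanSpace ℝ d, exp (-(β₀ / 2) * ‖w‖ ^ 2))))) ≤ 1 := by
      rw [← hCg]; exact hsmall
    have h := hasSum_boltzmannDuhamelTerm_tensorPow_vacuum hd hβ₀ (by positivity : 0 < 2 * c₀)
      hmild hcont hbound hsmall' (T := t + 1) (by linarith) s (t := t) ⟨ht, by linarith⟩ Zs
    rw [hf0] at h
    exact h

end BoltzmannSide

end

end Literature.MathematicalPhysics.KineticTheory
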